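import Mathlib
import HarnessLib
import Summits.KontsevichZagierPeriods.KontsevichZagierPeriods.Theses.FurushoPentagon
import Summits.KontsevichZagierPeriods.KontsevichZagierPeriods.Theorems.FurushoPentagonIntegerDivision
import Summits.KontsevichZagierPeriods.KontsevichZagierPeriods.Theorems.FurushoPentagonDoubleShuffleOfPentagon
import Literature.NumberTheory.Transcendental.KZRulesAssociator

/-!
# Crux `KernelModuloPeriodConjecture` (stmt-KontsevichZagierPeriods-15058), line `Sketch` —
stub G2 `stub_sectorKernelOfFormalSpan`: the sector kernel from formal Hoffman spanning

Write `P := KZ.FormalPeriodRing = KZ.FormalRep ⧸ KZ.relations`, `P_ℚ := KZ.FormalPeriodAlgebra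
= ℚ ⊗_ℤ P`, `ι := KZ.toPeriodAlgebra : P → P_ℚ` (`p ↦ 1 ⊗ p`) and `⟦ζ(s)⟧ := KZ.mzvClass s ∈ P`.

**Statement.** If every `ι ⟦ζ(s)⟧` (`s` admissible) lies in the `ℚ`-span of the Hoffman classes
`ι ⟦ζ(t)⟧`, `t ∈ {2,3}^×`, and the real Hoffman values `ζ(t)` are `ℚ`-linearly independent
(`MzvPeriodConjecture`), then every `ℤ`-combination `c` of simplex classes `[mzvRep s]` with
`KZ.eval c = 0` lies in `KZ.relations`.

**Proof.** Let `ψ := ι ∘ ⟦·⟧ : FormalRep →+ P_ℚ`. On a generator `[mzvRep s]`, `ψ` gives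
`ι ⟦ζ(s)⟧`, which is in the Hoffman span `H`; so `ψ c ∈ H` for every `c` in the subgroup generated
by the simplex classes, say `ψ c = Σ_t q_t · ι ⟦ζ(t)⟧` with `q : {Hoffman} →₀ ℚ`. Applying
`evalPQ = eval ⊗ ℚ` gives `eval c = Σ_t q_t ζ(t)`; if `eval c = 0`, Hoffman independence forces
`q = 0`, so `ψ c = 0`, i.e. `ι ⟦c⟧ = 0`. Finally `ι` is injective: `P_ℚ` is the localisation of `P`
at (the image of) `ℤ ∖ 0` (Mathlib `IsLocalization.tensorRight`), and every non-zero integer is a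
non-zero-divisor of `P` because division by a positive integer is a derived rule of the calculus
(the PROVED route item `IntegerDivision`, `integerDivision_proof`). Hence `⟦c⟧ = 0`, i.e.
`c ∈ KZ.relations` (`KZ.toFormalPeriod_eq_zero_iff`).

References: F. Brown, *Mixed Tate motives over ℤ*, Ann. of Math. 175 (2012), Thm 1.1 (Hoffman
elements span); M. Kontsevich, D. Zagier, *Periods* (2001), §1.2 (Conjecture 1), §4.1.
-/

noncomputable section

namespace Summit.KontsevichZagierPeriods.FurushoPentagon.KernelModuloPeriodConjecture

open Literature.NumberTheory.Transcendental
open Literature.NumberTheory.Transcendental.KZ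
open Summit.KontsevichZagierPeriods.KontsevichZagierPeriods.Theses.FurushoPentagon

/-! ## Torsion-freeness of `P` and injectivity of `P → P_ℚ` -/

/-- **`P = FormalRep ⧸ relations` has no `ℤ`-torsion**: for a non-zero integer `n`,
`n • c ∈ relations → c ∈ relations`. The case `n > 0` is the proved route item `IntegerDivision`
(`integerDivision_proof`); `n < 0` reduces to it since `relations` is a subgroup.
[Kontsevich–Zagier 2001, §1.2; folklore] -/
theorem sectorKernel_mem_relations_of_zsmul_mem {c : FormalRep} {n : ℤ} (hn : n ≠ 0)
    (h : n • c ∈ relations) : c ∈ relations := by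
  have hID : ∀ (c : FormalRep) (k : ℕ), 0 < k → k • c ∈ relations → c ∈ relations :=
    Summit.KontsevichZagierPeriods.FurushoPentagon.integerDivision_proof
  obtain ⟨k, rfl | rfl⟩ := Int.eq_nat_or_neg n
  · rw [natCast_zsmul] at h
    exact hID c k (Nat.pos_of_ne_zero fun hk => hn (by rw [hk, Nat.cast_zero])) h
  · rw [neg_zsmul, natCast_zsmul] at h
    exact hID c k (Nat.pos_of_ne_zero fun hk => hn (by rw [hk, Nat.cast_zero, neg_zero]))
      (neg_mem_iff.mp h)

/-- **Non-zero integers are non-zero-divisors of `P`**: `(n : P) * x = 0 → x = 0` for `n ≠ 0`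
(lift `x = ⟦c⟧`, `(n : P) * ⟦c⟧ = ⟦n • c⟧`, and use torsion-freeness). [folklore] -/
theorem sectorKernel_eq_zero_of_intCast_mul_eq_zero {n : ℤ} (hn : n ≠ 0) {x : FormalPeriodRing}
    (h : (n : FormalPeriodRing) * x = 0) : x = 0 := by
  obtain ⟨c, rfl⟩ := toFormalPeriod_surjective x
  rw [← zsmul_eq_mul, ← map_zsmul, toFormalPeriod_eq_zero_iff] at h
  exact toFormalPeriod_eq_zero_iff.mpr (sectorKernel_mem_relations_of_zsmul_mem hn h)

/-- The image of `ℤ ∖ 0` in `P` consists of non-zero-divisors. [folklore] -/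
theorem sectorKernel_algebraMapSubmonoid_le :
    Algebra.algebraMapSubmonoid FormalPeriodRing (nonZeroDivisors ℤ) ≤
      nonZeroDivisors FormalPeriodRing := by
  rintro x ⟨n, hn, rfl⟩
  have hn0 : (n : ℤ) ≠ 0 := nonZeroDivisors.ne_zero hn
  rw [mem_nonZeroDivisors_iff_right]
  intro y hy
  rw [mul_comm, eq_intCast] at hy
  exact sectorKernel_eq_zero_of_intCast_mul_eq_zero hn0 hy

/-- **`ι : P → P_ℚ = ℚ ⊗_ℤ P`, `p ↦ 1 ⊗ p`, is injective**: `P_ℚ` is the localisation of `P` at the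
image of `ℤ ∖ 0` (Mathlib `IsLocalization.tensorRight`, `ℚ = Frac ℤ`), and that submonoid consists
of non-zero-divisors (`sectorKernel_algebraMapSubmonoid_le`), so `IsLocalization.injective`
applies. [folklore] -/
theorem sectorKernel_toPeriodAlgebra_injective :
    Function.Injective (toPeriodAlgebra : FormalPeriodRing → FormalPeriodAlgebra) := by
  letI : Algebra FormalPeriodRing FormalPeriodAlgebra := Algebra.TensorProduct.rightAlgebra
  haveI : IsLocalization (Algebra.algebraMapSubmonoid FormalPeriodRing (nonZeroDivisors ℤ))
      FormalPeriodAlgebra :=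
    IsLocalization.tensorRight ℚ (nonZeroDivisors ℤ)
  exact IsLocalization.injective FormalPeriodAlgebra sectorKernel_algebraMapSubmonoid_le

/-! ## The stub -/

/-- **G2 — the sector kernel from formal Hoffman spanning and Hoffman independence.** If every
`1 ⊗ ⟦ζ(s)⟧` is a `ℚ`-combination of Hoffman classes in `P_ℚ` and the real Hoffman values are
`ℚ`-linearly independent (`MzvPeriodConjecture`), then every `ℤ`-combination of simplex classes of
value `0` is a relation: push `c` to `P_ℚ`, expand on the Hoffman classes, evaluate (`evalPQ`,
`evalP_mzvClass`), conclude the coefficients vanish by independence, and pull back along the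
injection `P ↪ P_ℚ` (`sectorKernel_toPeriodAlgebra_injective`, from the proved `IntegerDivision`).
[Brown 2012, Thm 1.1; Kontsevich–Zagier 2001, §1.2] -/
theorem stub_sectorKernelOfFormalSpan :
    (∀ s : List ℕ, MZV.IsAdmissible s → KZ.toPeriodAlgebra (KZ.mzvClass s) ∈ Submodule.span ℚ (Set.range (fun t : {t : List ℕ // MZV.IsHoffman t} => KZ.toPeriodAlgebra (KZ.mzvClass t.1)))) → MzvPeriodConjecture → ∀ c ∈ AddSubgroup.closure (Set.range (fun s : {s : List ℕ // MZV.IsAdmissible s} => KZ.of (KZ.mzvRep s.1 s.2 (KZ.mzvIntegrand_isSemialgebraicFunOn_holds s.1) (KZ.mzvIntegrand_integrableOn_holds s.1 s.2)))), KZ.eval c = 0 → c ∈ KZ.relations := by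
  intro hspan hZ c hc hev
  -- the universal realisation `ψ = ι ∘ ⟦·⟧ : FormalRep →+ P_ℚ`
  obtain ⟨ψ, hψ⟩ : ∃ ψ : FormalRep →+ FormalPeriodAlgebra,
      ∀ c : FormalRep, ψ c = toPeriodAlgebra (toFormalPeriod c) :=
    ⟨(toPeriodAlgebra : FormalPeriodRing →ₐ[ℤ] FormalPeriodAlgebra).toRingHom.toAddMonoidHom.comp
        (toFormalPeriod : FormalRep →ₙ+* FormalPeriodRing).toAddMonoidHom, fun _ => rfl⟩
  -- `ψ c` lies in the `ℚ`-span `H` of the Hoffman classes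
  have hcH : ψ c ∈ Submodule.span ℚ
      (Set.range (fun t : {t : List ℕ // MZV.IsHoffman t} => toPeriodAlgebra (mzvClass t.1))) := by
    have hle : AddSubgroup.closure (Set.range (fun s : {s : List ℕ // MZV.IsAdmissible s} =>
        of (mzvRep s.1 s.2 (mzvIntegrand_isSemialgebraicFunOn_holds s.1)
          (mzvIntegrand_integrableOn_holds s.1 s.2)))) ≤
        (Submodule.span ℚ (Set.range (fun t : {t : List ℕ // MZV.IsHoffman t} =>
          toPeriodAlgebra (mzvClass t.1)))).toAddSubgroup.comap ψ := by
      rw [AddSubgroup.closure_le]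
      rintro _ ⟨s, rfl⟩
      rw [SetLike.mem_coe, AddSubgroup.mem_comap, Submodule.mem_toAddSubgroup, hψ,
        ← mzvClass_of_isAdmissible s.2]
      exact hspan s.1 s.2
    exact hle hc
  obtain ⟨q, hq⟩ := (Finsupp.mem_span_range_iff_exists_finsupp).1 hcH
  -- evaluate: `eval c = Σ_t q_t ζ(t)`
  have hq0 : evalPQ (ψ c) = Finsupp.linearCombination ℚ
      (fun u : {u : List ℕ // MZV.IsHoffman u} => multipleZeta u.1) q := by
    rw [← hq, Finsupp.linearCombination_apply, map_finsuppSum]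
    exact Finsupp.sum_congr fun t _ => by
      rw [map_smul, evalPQ_toPeriodAlgebra, evalP_mzvClass t.2.isAdmissible]
  have hev' : evalPQ (ψ c) = 0 := by
    rw [hψ, evalPQ_toPeriodAlgebra, evalP_toFormalPeriod, hev]
  -- Hoffman independence kills the coefficients
  have hZ' : LinearIndependent ℚ (fun u : {u : List ℕ // MZV.IsHoffman u} => multipleZeta u.1) := hZ
  have hq1 : q = 0 := linearIndependent_iff.1 hZ' q (by rw [← hq0, hev'])
  have hψc : toPeriodAlgebra (toFormalPeriod c) = 0 := by
    rw [← hψ, ← hq, hq1, Finsupp.sum_zero_index]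
  -- pull back along `P ↪ P_ℚ`
  exact toFormalPeriod_eq_zero_iff.mp
    ((injective_iff_map_eq_zero toPeriodAlgebra).1 sectorKernel_toPeriodAlgebra_injective _ hψc)

end Summit.KontsevichZagierPeriods.FurushoPentagon.KernelModuloPeriodConjecture

end
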